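import Literature.NumberTheory.LFunctions.LagariasDifferencedXiProofs
import Literature.Analysis.Approximation.TuranNazarovZeroFree
import Mathlib.Analysis.InnerProductSpace.Harmonic.Constructions
import HarnessLib

/-!
# Proof of Lagarias 2005, Lemma 2.2 (second half): de Branges' lemma — the zeros of `A` and `B` interlace

LINE 1 — LABEL: RH-FREE (a theorem about every entire `E` with `|E(s)| > |E(1 − s̄)|` on `Re s > ½`; no `ξ`, no
RH). bears_on: LADDER-RH B-C/B-P (COLUMN 6). WHAT THIS IS NOT: a discharge of a printed lemma of the corpus (the
`s`-variable form of de Branges' 1959 lemma); nothing here bears on the truth of RH.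

Discharge (cell rh-crit/dbl, node La05:L2.2):

* `Literature.NumberTheory.LFunctions.lagarias2005_lemma_2_2_interlace_holds : lagarias2005_lemma_2_2_interlace`
  (J. C. Lagarias, Acta Arith. 120 (2005) = arXiv:math/0601653, **Lemma 2.2**, arXiv p. 6, second conclusion, with
  Remark (1): "these zeros interlace", counting multiplicity) — in the cell's index-free rendering
  `CritZerosInterlace (critRePart E) (critImPart E)` (`LagariasDifferencedXiDefs.lean`): on every height window
  `(t₁, t₂]` the numbers of critical-line zeros of `A` and of `B`, with multiplicity, differ by at most one.

## The printed proof and how it is followed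

Lagarias ((2.7)–(2.8), arXiv pp. 6–7): with `E(½+it) = |E(½+it)| e^{iφ(t)}`, (2.6) gives `|E|² φ′ ≥ 0`, `φ` is
non-constant (reflection principle), hence strictly increasing, and `A = |E| cos φ`, `B = −|E| sin φ` on the line,
"this certifies that the zeros of `A(t)` and `B(t)` interlace". For the statement WITH MULTIPLICITY (Remark (1)) one
needs the strict inequality `φ′(t) > 0` (a zero of `φ′` at a zero of `A` would be a multiple zero of `A` with
`B ≠ 0` there), which is de Branges' form of the lemma; and the critical-line zeros of `E` itself (allowed by (2.6);
there `A` and `B` vanish together) have to be accounted for. We proceed as follows.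

1. **Strict phase velocity** (`re_logDeriv_pos_of_critHB`): for `E(s₀) ≠ 0`, `s₀ = ½ + it`, one has
   `Re E′/E(s₀) > 0` (`= φ′(t)` in Lagarias' normalisation). Proof: `u = log|E| − log|E♯|`
   (`E♯(s) = conj E(1 − s̄)`, `critReflect`) is harmonic near `s₀` (Mathlib `AnalyticAt.harmonicAt_log_norm`),
   `> 0` to the right of the line by (2.6) and `= 0` on it; Harnack's inequality in the disc `B(s₀ + R, R)` tangent
   to the line (tree: `Literature.Analysis.Approximation.TuranNazarov.harnack`, from Mathlib's Poisson integral
   formula) gives `u(s₀ + ε) ≥ κ ε`, `κ = u(s₀+R)/(2R) > 0`, while `u(s₀ + ε) = L(ε) − L(−ε)` with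
   `L(σ) = log|E(s₀ + σ)|`, `L′(0) = Re E′/E(s₀)`; hence `2 Re E′/E(s₀) ≥ κ`. (This is the boundary-point lemma for
   the positive harmonic function `u`; it replaces the non-strict limit (2.7).)
2. **Zero-free windows** (`critZeroCount_window_of_ne_zero`): if `E ≠ 0` on the segment over `[t₁, t₂]`, then on it
   the zeros of `A`, `B` are simple (`A(s₀) = A′(s₀) = 0` would give `Re E(s₀) = Im E′(s₀) = 0`, i.e.
   `Re E′/E(s₀) = 0` — `deriv_critRePart_ne_zero_of_ne`) and strictly alternate (`exists_critImPart_zero_btwn`,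
   `exists_critRePart_zero_btwn`: the local phase argument `exists_re_eq_zero_btwn` of
   `LagariasDifferencedXiProofs.lean` applied to `W(t) = E(½+it)`, `Im W′/W = Re E′/E > 0`), so the counts on
   `(t₁, t₂]` are cardinalities of finite sets each strictly separating the other, which differ by at most one.
3. **Dividing out critical-line zeros** (`critZeroCount_window`, induction on the total multiplicity
   `critZeroCountOn E (Icc t₁ t₂)`): if `E(s₀) = 0`, `s₀ = ½ + it₀`, `t₀ ∈ [t₁, t₂]`, put `E₁ := i · dslope E s₀`
   (`= iE(s)/(s − s₀)`, entire). Then `(s − s₀)E₁ = iE`, `(s − s₀)A_{E₁} = iA_E`, `(s − s₀)B_{E₁} = iB_E`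
   (because `(s − s₀)♯ = −(s − s₀)` for `s₀` on the line — the factor `i` compensates the sign), `E₁` again
   satisfies (2.6) (`|1 − s̄ − s₀| = |s − s₀|`), and the multiplicities of `E`, `A_E`, `B_E` exceed those of `E₁`,
   `A_{E₁}`, `B_{E₁}` by exactly one at `s₀` and agree elsewhere (`analyticOrderAt_mul`); so the window difference
   `N_A − N_B` is unchanged while the multiplicity of `E` on the segment drops by one.

Everything is PROVED; no named fact is introduced.

## References

* [Lagarias2005] J. C. Lagarias, *Zero spacing distributions for differenced L-functions*, Acta Arith. 120
  (2005), no. 2, 159–184, doi:10.4064/aa120-2-4 = arXiv:math/0601653 — Lemma 2.2, Remarks (1)–(2) and the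
  proof ((2.6a)–(2.8)), arXiv pp. 6–7 (held text p0005); Lagarias attributes the lemma to L. de Branges,
  *Some mean squares of entire functions*, Proc. AMS 10 (1959) 833–839 [deB59].
-/

noncomputable section

open Complex Set Filter Topology Metric InnerProductSpace
open scoped ComplexConjugate Real

namespace Literature.NumberTheory.LFunctions

/-! ## The reflection `E♯(s) = conj E(1 − s̄)`: derivative -/

/-- `(E♯)′(s) = −conj E′(1 − s̄)` for the involution `E♯(s) = conj E(1 − s̄)`. [cite: Lagarias2005, §2, before Lemma 2.2 (arXiv p. 6; held text p0005)] -/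
theorem hasDerivAt_critReflect {G : ℂ → ℂ} (hG : Differentiable ℂ G) (s : ℂ) :
    HasDerivAt (critReflect G) (-conj (deriv G (1 - conj s))) s := by
  have h1 : HasDerivAt (fun w ↦ G (1 - w)) (-deriv G (1 - conj s)) (conj s) :=
    HasDerivAt.comp_const_sub 1 (conj s) (hG _).hasDerivAt
  have h2 := h1.conj_conj
  rw [Complex.conj_conj, map_neg] at h2
  exact h2

/-- "`E♯` … is an involution acting on entire functions": `E♯` is entire. [cite: Lagarias2005, §2, before Lemma 2.2 (arXiv p. 6; held text p0005)] -/
theorem differentiable_critReflect {G : ℂ → ℂ} (hG : Differentiable ℂ G) :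
    Differentiable ℂ (critReflect G) := fun s ↦ (hasDerivAt_critReflect hG s).differentiableAt

/-- Along the horizontal line through `s₀ = ½ + it`: `‖E♯(s₀ + σ)‖ = ‖E(s₀ − σ)‖` (the quantity compared in (2.7)). [cite: Lagarias2005, Lemma 2.2 and its proof (arXiv pp. 6–7; held text p0005)] -/
theorem norm_critReflect_critLine_add (G : ℂ → ℂ) (t σ : ℝ) :
    ‖critReflect G (1 / 2 + t * I + σ)‖ = ‖G (1 / 2 + t * I - σ)‖ := by
  rw [critReflect_apply, Complex.norm_conj]
  congr 2
  simp only [map_add, map_mul, Complex.conj_ofReal, Complex.conj_I, map_div₀, map_one, map_ofNat]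
  ring

/-! ## Hopf's lemma for (2.6): the phase velocity is strictly positive -/

/-- **Strict phase velocity** (de Branges; the strict form of Lagarias' (2.8)): if `G` is entire with
`|G(s)| > |G(1 − s̄)|` for `Re s > ½` and `G(½ + it) ≠ 0`, then `Re G′/G(½ + it) > 0`. Proof:
`u = log|G| − log|G♯|` is harmonic near `s₀ = ½ + it`, positive to the right of the critical line and zero
on it; Harnack's inequality in a disc tangent to the line at `s₀` bounds `u(s₀ + ε) ≥ κ ε`, while
`u(s₀ + ε) = L(ε) − L(−ε)` with `L(σ) = log|G(s₀ + σ)|`, `L′(0) = Re G′/G(s₀)`.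
[cite: Lagarias2005, Lemma 2.2, proof, (2.7)–(2.8) (arXiv pp. 6–7; held text p0005)] -/
theorem re_logDeriv_pos_of_critHB {G : ℂ → ℂ} (hG : Differentiable ℂ G)
    (hHB : ∀ s : ℂ, 1 / 2 < s.re → ‖G (1 - conj s)‖ < ‖G s‖) {t : ℝ} (hne : G (1 / 2 + t * I) ≠ 0) :
    0 < (logDeriv G (1 / 2 + t * I)).re := by
  set s₀ : ℂ := 1 / 2 + t * I with hs₀
  have hGr : Differentiable ℂ (critReflect G) := differentiable_critReflect hG
  have hGr0 : critReflect G s₀ ≠ 0 := by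
    rw [hs₀, critReflect_critical, map_ne_zero]; exact hne
  -- a ball around `s₀` free of zeros of `G` and `G♯`
  obtain ⟨δ, hδ, hball⟩ : ∃ δ > 0, ∀ z ∈ ball s₀ δ, G z ≠ 0 ∧ critReflect G z ≠ 0 := by
    have h1 : ∀ᶠ z in 𝓝 s₀, G z ≠ 0 := (hG.continuous.continuousAt).eventually_ne hne
    have h2 : ∀ᶠ z in 𝓝 s₀, critReflect G z ≠ 0 := (hGr.continuous.continuousAt).eventually_ne hGr0
    obtain ⟨δ, hδ, h⟩ := Metric.eventually_nhds_iff.1 (h1.and h2)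
    exact ⟨δ, hδ, fun z hz ↦ h hz⟩
  set R : ℝ := δ / 3 with hR
  have hRpos : 0 < R := by positivity
  set c : ℂ := s₀ + R with hc
  set u : ℂ → ℝ := fun z ↦ Real.log ‖G z‖ - Real.log ‖critReflect G z‖ with hu
  have hsub : closedBall c R ⊆ ball s₀ δ := by
    intro z hz
    rw [mem_closedBall, dist_eq_norm] at hz
    rw [mem_ball, dist_eq_norm]
    calc ‖z - s₀‖ = ‖(z - c) + (R : ℂ)‖ := by rw [hc]; ring_nf
      _ ≤ ‖z - c‖ + ‖(R : ℂ)‖ := norm_add_le _ _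
      _ ≤ R + R := by rw [Complex.norm_real, Real.norm_of_nonneg hRpos.le]; linarith
      _ < δ := by rw [hR]; linarith
  -- harmonicity
  have hharm : HarmonicOnNhd u (closedBall c R) := by
    intro z hz
    obtain ⟨hz1, hz2⟩ := hball z (hsub hz)
    exact ((hG.analyticAt z).harmonicAt_log_norm hz1).sub ((hGr.analyticAt z).harmonicAt_log_norm hz2)
  -- sign of `u` on the closed right half-plane part of the ball
  have hupos : ∀ z ∈ closedBall c R, 1 / 2 < z.re → 0 < u z := by
    intro z hz hzre
    obtain ⟨hz1, hz2⟩ := hball z (hsub hz)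
    have hlt : ‖critReflect G z‖ < ‖G z‖ := by
      rw [critReflect_apply, Complex.norm_conj]; exact hHB z hzre
    have := Real.log_lt_log (norm_pos_iff.2 hz2) hlt
    simp only [hu]; linarith
  have hunn : ∀ z ∈ sphere c R, 0 ≤ u z := by
    intro z hz
    have hzre : 1 / 2 ≤ z.re := by
      rw [mem_sphere, dist_eq_norm] at hz
      have h1 : |(z - c).re| ≤ ‖z - c‖ := Complex.abs_re_le_norm _
      have h2 : (z - c).re = z.re - (1 / 2 + R) := by rw [hc, hs₀]; simp
      rw [h2, hz] at h1
      have := neg_abs_le (z.re - (1 / 2 + R))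
      linarith [abs_le.1 h1]
    rcases hzre.lt_or_eq with h | h
    · exact (hupos z (sphere_subset_closedBall hz) h).le
    · -- on the critical line `u = 0`
      have hz' : z = 1 / 2 + (z.im : ℝ) * I := Complex.ext (by simp [← h]) (by simp)
      have : ‖critReflect G z‖ = ‖G z‖ := by
        rw [hz', critReflect_critical, Complex.norm_conj]
      simp only [hu, this, sub_self]; rfl
  have huc : 0 < u c := hupos c (mem_closedBall_self hRpos.le) (by rw [hc, hs₀]; simp; linarith)
  -- Harnack at `w = s₀ + ε`
  have hHarnack : ∀ ε : ℝ, 0 < ε → ε < R → ε * (u c / (2 * R)) ≤ u (s₀ + ε) := by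
    intro ε hε hεR
    have hw : (s₀ + ε : ℂ) ∈ ball c R := by
      rw [mem_ball, dist_eq_norm, hc, show (s₀ : ℂ) + ε - (s₀ + R) = ((ε - R : ℝ) : ℂ) by push_cast; ring,
        Complex.norm_real, Real.norm_eq_abs, abs_of_neg (by linarith)]
      linarith
    have key := (Literature.Analysis.Approximation.TuranNazarov.harnack hharm hunn hw).1
    have hnorm : ‖(s₀ : ℂ) + ε - c‖ = R - ε := by
      rw [hc, show (s₀ : ℂ) + ε - (s₀ + R) = ((ε - R : ℝ) : ℂ) by push_cast; ring, Complex.norm_real,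
        Real.norm_eq_abs, abs_of_neg (by linarith)]
      ring
    rw [hnorm] at key
    have h2R : 0 < R + (R - ε) := by linarith
    calc ε * (u c / (2 * R)) ≤ (R - (R - ε)) / (R + (R - ε)) * u c := by
          rw [show R - (R - ε) = ε by ring, div_mul_eq_mul_div, mul_div_assoc]
          apply mul_le_mul_of_nonneg_left _ hε.le
          exact div_le_div_of_nonneg_left huc.le h2R (by linarith)
      _ ≤ u (s₀ + ε) := key
  -- `u(s₀ + σ) = L(σ) − L(−σ)` with `L(σ) = log ‖G(s₀ + σ)‖`
  set L : ℝ → ℝ := fun σ ↦ Real.log ‖G (s₀ + σ)‖ with hL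
  have huL : ∀ σ : ℝ, u (s₀ + σ) = L σ - L (-σ) := by
    intro σ
    simp only [hu, hL, hs₀, norm_critReflect_critLine_add, Complex.ofReal_neg]
    rfl
  -- `L` is differentiable at `0` with derivative `Re G′/G(s₀)`
  have hLd : HasDerivAt L ((logDeriv G s₀).re) 0 := by
    -- replace `G` by `-G` if necessary so that `G s₀ ∈ slitPlane`
    obtain ⟨G₁, hG₁d, hG₁n, hG₁s, hG₁l⟩ : ∃ G₁ : ℂ → ℂ, Differentiable ℂ G₁ ∧ (∀ z, ‖G₁ z‖ = ‖G z‖) ∧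
        G₁ s₀ ∈ slitPlane ∧ logDeriv G₁ s₀ = logDeriv G s₀ := by
      rcases Complex.mem_slitPlane_or_neg_mem_slitPlane hne with h | h
      · exact ⟨G, hG, fun z ↦ rfl, h, rfl⟩
      · refine ⟨-G, hG.neg, fun z ↦ norm_neg _, h, ?_⟩
        rw [logDeriv_apply, logDeriv_apply, deriv.neg, Pi.neg_apply, neg_div_neg_eq]
    have e1 : L = fun σ : ℝ ↦ (Complex.log (G₁ (s₀ + (σ : ℂ)))).re := by
      funext σ; rw [hL, Complex.log_re, hG₁n]
    rw [e1]
    have h1 : HasDerivAt (fun σ : ℝ ↦ G₁ (s₀ + σ)) (deriv G₁ s₀) 0 := by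
      have h0 : HasDerivAt (fun w : ℂ ↦ G₁ (s₀ + w)) (deriv G₁ (s₀ + 0)) (0 : ℂ) :=
        HasDerivAt.comp_const_add s₀ 0 (hG₁d _).hasDerivAt
      rw [add_zero] at h0
      have := h0.comp_ofReal
      simpa using this
    have h2 : HasDerivAt (fun σ : ℝ ↦ Complex.log (G₁ (s₀ + σ))) (deriv G₁ s₀ / G₁ (s₀ + 0)) 0 :=
      h1.clog_real (by simpa using hG₁s)
    rw [add_zero] at h2
    have h3 := Complex.reCLM.hasFDerivAt.comp_hasDerivAt (0 : ℝ) h2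
    have e2 : (logDeriv G s₀).re = Complex.reCLM (deriv G₁ s₀ / G₁ s₀) := by
      rw [← hG₁l, logDeriv_apply, Complex.reCLM_apply]
    rw [e2]
    simpa [Function.comp_def] using h3
  -- the symmetric difference quotient tends to `2 L′(0)` and is `≥ u c / (2R)`
  have hT : Tendsto (fun ε : ℝ ↦ (L ε - L (-ε)) / ε) (𝓝[>] 0) (𝓝 (2 * (logDeriv G s₀).re)) := by
    have hsl : Tendsto (slope L 0) (𝓝[≠] 0) (𝓝 (logDeriv G s₀).re) := hasDerivAt_iff_tendsto_slope.1 hLd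
    have hA : Tendsto (slope L 0) (𝓝[>] 0) (𝓝 (logDeriv G s₀).re) :=
      hsl.mono_left (nhdsWithin_mono _ fun x hx ↦ ne_of_gt hx)
    have hB : Tendsto (fun ε : ℝ ↦ slope L 0 (-ε)) (𝓝[>] 0) (𝓝 (logDeriv G s₀).re) := by
      refine hsl.comp ?_
      have : Tendsto (fun ε : ℝ ↦ -ε) (𝓝[>] (0 : ℝ)) (𝓝[<] (0 : ℝ)) := by
        simpa using tendsto_neg_nhdsGT_neg (a := (0 : ℝ))
      exact this.mono_right (nhdsWithin_mono _ fun x hx ↦ ne_of_lt hx)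
    have hsum := hA.add hB
    rw [← two_mul] at hsum
    refine hsum.congr' ?_
    filter_upwards [self_mem_nhdsWithin] with ε (hε : 0 < ε)
    simp only [slope, vsub_eq_sub, sub_zero, smul_eq_mul]
    field_simp
    ring
  have hge : u c / (2 * R) ≤ 2 * (logDeriv G s₀).re := by
    refine ge_of_tendsto hT ?_
    have hmem : Ioo (0 : ℝ) R ∈ 𝓝[>] (0 : ℝ) := Ioo_mem_nhdsGT hRpos
    filter_upwards [hmem] with ε hε
    rw [← huL, le_div_iff₀ hε.1]
    have := hHarnack ε hε.1 hε.2
    linarith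
  have hκ : 0 < u c / (2 * R) := by positivity
  linarith


/-! ## Values and derivatives of `A`, `B` on the critical line -/

/-- `1 − conj(½ + it) = ½ + it`. [folklore] -/
private theorem one_sub_conj_critLine (t : ℝ) : (1 : ℂ) - conj (1 / 2 + t * I) = 1 / 2 + t * I := by
  apply Complex.ext
  · simp; norm_num
  · simp

/-- `A(½+it) = 0 ⟺ Re E(½+it) = 0`. [cite: Lagarias2005, Lemma 2.2 (arXiv p. 6; held text p0005 L12)] -/
theorem critRePart_critical_eq_zero_iff (E : ℂ → ℂ) (t : ℝ) :
    critRePart E (1 / 2 + t * I) = 0 ↔ (E (1 / 2 + t * I)).re = 0 := by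
  rw [critRePart_critical, Complex.ofReal_eq_zero]

/-- `B(½+it) = 0 ⟺ Im E(½+it) = 0`. [cite: Lagarias2005, Lemma 2.2 (arXiv p. 6; held text p0005 L12)] -/
theorem critImPart_critical_eq_zero_iff (E : ℂ → ℂ) (t : ℝ) :
    critImPart E (1 / 2 + t * I) = 0 ↔ (E (1 / 2 + t * I)).im = 0 := by
  rw [critImPart_critical, Complex.ofReal_eq_zero, neg_eq_zero]

/-- `A′(s) = ½ (E′(s) − conj E′(1 − s̄))` for `A = ½(E + E♯)`. [cite: Lagarias2005, Lemma 2.2 and its proof (arXiv pp. 6–7; held text p0005)] -/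
theorem hasDerivAt_critRePart {E : ℂ → ℂ} (hE : Differentiable ℂ E) (s : ℂ) :
    HasDerivAt (critRePart E) ((deriv E s - conj (deriv E (1 - conj s))) / 2) s := by
  have h := ((hE s).hasDerivAt.add (hasDerivAt_critReflect hE s)).div_const 2
  rw [← sub_eq_add_neg] at h
  exact h

/-- `B′(s) = (i/2) (E′(s) + conj E′(1 − s̄))` for `B = (i/2)(E − E♯)`. [cite: Lagarias2005, Lemma 2.2 and its proof (arXiv pp. 6–7; held text p0005)] -/
theorem hasDerivAt_critImPart {E : ℂ → ℂ} (hE : Differentiable ℂ E) (s : ℂ) :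
    HasDerivAt (critImPart E) (I * (deriv E s + conj (deriv E (1 - conj s))) / 2) s := by
  have h := (((hE s).hasDerivAt.sub (hasDerivAt_critReflect hE s)).const_mul I).div_const 2
  rw [sub_neg_eq_add] at h
  exact h

/-- `A′(½+it) = i · Im E′(½+it)` ("`d/ds = i d/dt` on the line `s = ½ + it`"). [cite: Lagarias2005, Lemma 2.2 and its proof (arXiv pp. 6–7; held text p0005)] -/
theorem deriv_critRePart_critical {E : ℂ → ℂ} (hE : Differentiable ℂ E) (t : ℝ) :
    deriv (critRePart E) (1 / 2 + t * I) = ((deriv E (1 / 2 + t * I)).im : ℂ) * I := by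
  rw [(hasDerivAt_critRePart hE _).deriv, one_sub_conj_critLine, Complex.sub_conj]
  push_cast
  ring

/-- `B′(½+it) = i · Re E′(½+it)`. [cite: Lagarias2005, Lemma 2.2 and its proof (arXiv pp. 6–7; held text p0005)] -/
theorem deriv_critImPart_critical {E : ℂ → ℂ} (hE : Differentiable ℂ E) (t : ℝ) :
    deriv (critImPart E) (1 / 2 + t * I) = I * ((deriv E (1 / 2 + t * I)).re : ℂ) := by
  rw [(hasDerivAt_critImPart hE _).deriv, one_sub_conj_critLine, Complex.add_conj]
  push_cast
  ring

/-- "`d/ds = i d/dt` on the line `s = ½ + it`": `d/dt E(½ + it) = i E′(½ + it)`. [cite: Lagarias2005, Lemma 2.2 and its proof (arXiv pp. 6–7; held text p0005)] -/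
theorem hasDerivAt_critLine_comp {E : ℂ → ℂ} (hE : Differentiable ℂ E) (t : ℝ) :
    HasDerivAt (fun t : ℝ ↦ E (1 / 2 + t * I)) (deriv E (1 / 2 + t * I) * I) t := by
  have hp : HasDerivAt (fun t : ℝ ↦ (1 / 2 : ℂ) + t * I) I t := by
    have := ((hasDerivAt_id t).ofReal_comp).mul_const I |>.const_add (1 / 2 : ℂ)
    simpa using this
  have hξ : HasDerivAt E (deriv E (1 / 2 + t * I)) ((1 / 2 : ℂ) + t * I) := (hE _).hasDerivAt
  have := hξ.comp t hp
  simpa [Function.comp_def] using this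

section ZeroFree

variable {E : ℂ → ℂ} (hE : Differentiable ℂ E) (hHB : ∀ s : ℂ, 1 / 2 < s.re → ‖E (1 - conj s)‖ < ‖E s‖)
include hE hHB

/-- A zero of `A` on the critical line at which `E ≠ 0` is simple. [cite: Lagarias2005, Lemma 2.2, proof (arXiv pp. 6–7; held text p0005)] -/
theorem deriv_critRePart_ne_zero_of_ne {t : ℝ} (hne : E (1 / 2 + t * I) ≠ 0)
    (h0 : critRePart E (1 / 2 + t * I) = 0) : deriv (critRePart E) (1 / 2 + t * I) ≠ 0 := by
  intro hd
  rw [critRePart_critical_eq_zero_iff] at h0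
  rw [deriv_critRePart_critical hE, mul_eq_zero, Complex.ofReal_eq_zero] at hd
  have hd' : (deriv E (1 / 2 + t * I)).im = 0 := by
    rcases hd with hd | hd
    · exact hd
    · exact absurd hd I_ne_zero
  have hp := re_logDeriv_pos_of_critHB hE hHB hne
  rw [logDeriv_apply, Complex.div_re, h0, hd'] at hp
  simp at hp

/-- A zero of `B` on the critical line at which `E ≠ 0` is simple. [cite: Lagarias2005, Lemma 2.2, proof (arXiv pp. 6–7; held text p0005)] -/
theorem deriv_critImPart_ne_zero_of_ne {t : ℝ} (hne : E (1 / 2 + t * I) ≠ 0)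
    (h0 : critImPart E (1 / 2 + t * I) = 0) : deriv (critImPart E) (1 / 2 + t * I) ≠ 0 := by
  intro hd
  rw [critImPart_critical_eq_zero_iff] at h0
  rw [deriv_critImPart_critical hE, mul_eq_zero, Complex.ofReal_eq_zero] at hd
  have hd' : (deriv E (1 / 2 + t * I)).re = 0 := by
    rcases hd with hd | hd
    · exact absurd hd I_ne_zero
    · exact hd
  have hp := re_logDeriv_pos_of_critHB hE hHB hne
  rw [logDeriv_apply, Complex.div_re, h0, hd'] at hp
  simp at hp

/-- Strictly between two zeros of `A` on a zero-free (for `E`) stretch of the critical line lies a zero of `B`.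
[cite: Lagarias2005, Lemma 2.2, proof, (2.7)–(2.8) (arXiv pp. 6–7; held text p0005)] -/
theorem exists_critImPart_zero_btwn {x y : ℝ} (hxy : x < y) (hne : ∀ t ∈ Icc x y, E (1 / 2 + t * I) ≠ 0)
    (hx : critRePart E (1 / 2 + x * I) = 0) (hy : critRePart E (1 / 2 + y * I) = 0) :
    ∃ z ∈ Ioo x y, critImPart E (1 / 2 + z * I) = 0 := by
  rw [critRePart_critical_eq_zero_iff] at hx hy
  have hW := hasDerivAt_critLine_comp hE
  obtain ⟨z, hz, hz0⟩ := exists_re_eq_zero_btwn (x := x) (y := y)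
    (W := fun t ↦ I * E (1 / 2 + t * I)) (W' := fun t ↦ I * (deriv E (1 / 2 + t * I) * I)) hxy
    ((continuous_const.mul (hE.continuous.comp (by fun_prop))).continuousOn)
    (fun t ht ↦ mul_ne_zero I_ne_zero (hne t ht))
    (fun t _ ↦ (hW t).const_mul I)
    (fun t ht ↦ by
      rw [mul_div_mul_left _ _ I_ne_zero, mul_div_right_comm, Complex.mul_I_im, ← logDeriv_apply]
      exact re_logDeriv_pos_of_critHB hE hHB (hne t (Ioo_subset_Icc_self ht)))
    (by rw [show ∀ w : ℂ, (I * w).im = w.re from fun w ↦ by simp]; exact hx)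
    (by rw [show ∀ w : ℂ, (I * w).im = w.re from fun w ↦ by simp]; exact hy)
  refine ⟨z, hz, ?_⟩
  rw [critImPart_critical_eq_zero_iff]
  rw [show ∀ w : ℂ, (I * w).re = -w.im from fun w ↦ by simp, neg_eq_zero] at hz0
  exact hz0

/-- Strictly between two zeros of `B` on a zero-free (for `E`) stretch of the critical line lies a zero of `A`.
[cite: Lagarias2005, Lemma 2.2, proof, (2.7)–(2.8) (arXiv pp. 6–7; held text p0005)] -/
theorem exists_critRePart_zero_btwn {x y : ℝ} (hxy : x < y) (hne : ∀ t ∈ Icc x y, E (1 / 2 + t * I) ≠ 0)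
    (hx : critImPart E (1 / 2 + x * I) = 0) (hy : critImPart E (1 / 2 + y * I) = 0) :
    ∃ z ∈ Ioo x y, critRePart E (1 / 2 + z * I) = 0 := by
  rw [critImPart_critical_eq_zero_iff] at hx hy
  have hW := hasDerivAt_critLine_comp hE
  obtain ⟨z, hz, hz0⟩ := exists_re_eq_zero_btwn (x := x) (y := y)
    (W := fun t ↦ E (1 / 2 + t * I)) (W' := fun t ↦ deriv E (1 / 2 + t * I) * I) hxy
    ((hE.continuous.comp (by fun_prop)).continuousOn)
    (fun t ht ↦ hne t ht)
    (fun t _ ↦ hW t)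
    (fun t ht ↦ by
      rw [mul_div_right_comm, Complex.mul_I_im, ← logDeriv_apply]
      exact re_logDeriv_pos_of_critHB hE hHB (hne t (Ioo_subset_Icc_self ht)))
    hx hy
  exact ⟨z, hz, (critRePart_critical_eq_zero_iff E z).2 hz0⟩

end ZeroFree


/-! ## Counting: finsum forms, local cardinalities, and the effect of dividing out a line zero -/

/-- The order of vanishing of an entire function that is not identically zero is finite everywhere. [folklore] -/
private theorem analyticOrderAt_ne_top {F : ℂ → ℂ} (hF : Differentiable ℂ F) {x : ℂ} (hx : F x ≠ 0) (z : ℂ) :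
    analyticOrderAt F z ≠ ⊤ := by
  intro h
  have := (AnalyticOnNhd.analyticOrderAt_eq_top_iff_eq_zero z (fun w ↦ hF.analyticAt w)).1 h
  exact hx (by rw [this]; rfl)

/-- For entire `F`, the multiplicity `analyticOrderNatAt F (½+it)` vanishes off `critZeroOrdinates F`, so the
restriction to `critZeroOrdinates F` in `critZeroCountOn` ("counting zeros with multiplicity") may be dropped.
[cite: Lagarias2005, Remark (1) after Lemma 2.2 (arXiv p. 6; held text p0005)] -/
theorem critZeroCountOn_eq_finsum {F : ℂ → ℂ} (hF : Differentiable ℂ F) (S : Set ℝ) :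
    critZeroCountOn F S = ∑ᶠ t ∈ S, analyticOrderNatAt F (1 / 2 + t * I) := by
  unfold critZeroCountOn
  apply finsum_mem_inter_support_eq
  ext t
  simp only [mem_inter_iff, mem_critZeroOrdinates, Function.mem_support, ne_eq]
  constructor
  · rintro ⟨⟨-, hS⟩, h⟩; exact ⟨hS, h⟩
  · rintro ⟨hS, h⟩
    refine ⟨⟨?_, hS⟩, h⟩
    by_contra h0
    apply h
    rw [analyticOrderNatAt, (hF.analyticAt _).analyticOrderAt_eq_zero.2 h0]
    rfl

/-- Local version of `critZeroCountOn_eq_card`: if the zeros of `F` with ordinate in `S` are simple and finitely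
many, the count with multiplicity is their number. [folklore] -/
private theorem critZeroCountOn_eq_card_of {F : ℂ → ℂ} (hF : Differentiable ℂ F) {S : Set ℝ}
    (hsimple : ∀ t ∈ S, F (1 / 2 + t * I) = 0 → deriv F (1 / 2 + t * I) ≠ 0)
    (hfin : (critZeroOrdinates F ∩ S).Finite) : critZeroCountOn F S = hfin.toFinset.card := by
  unfold critZeroCountOn
  rw [finsum_mem_eq_finite_toFinset_sum _ hfin, Finset.card_eq_sum_ones]
  refine Finset.sum_congr rfl fun t ht ↦ ?_
  obtain ⟨h0, hS⟩ := hfin.mem_toFinset.1 ht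
  rw [mem_critZeroOrdinates] at h0
  have h1 : analyticOrderAt F (1 / 2 + t * I) = 1 :=
    (hF.analyticAt _).analyticOrderAt_eq_one_of_zero_deriv_ne_zero h0 (hsimple t hS h0)
  rw [analyticOrderNatAt, h1]
  rfl

/-- The parametrisation `t ↦ ½ + it` of the critical line is injective. [folklore] -/
private theorem critLine_injective' : Function.Injective (fun t : ℝ ↦ (1 / 2 : ℂ) + t * I) := by
  intro t₁ t₂ h
  have := congrArg Complex.im h
  simpa using this

/-- For an entire `F`, not identically zero, the zero ordinates in a bounded height window are finite. [folklore] -/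
private theorem finite_critZeroOrdinates_inter' {F : ℂ → ℂ} (hF : Differentiable ℂ F) {x : ℂ} (hx : F x ≠ 0)
    {S : Set ℝ} {a b : ℝ} (hS : S ⊆ Icc a b) : (critZeroOrdinates F ∩ S).Finite := by
  have hK : IsCompact ((fun t : ℝ ↦ (1 / 2 : ℂ) + t * I) '' Icc a b) := isCompact_Icc.image (by fun_prop)
  have hcod : (F ⁻¹' {0})ᶜ ∈ Filter.codiscrete ℂ :=
    AnalyticOnNhd.preimage_zero_mem_codiscrete (fun z _ ↦ hF.analyticAt z) hx
  obtain ⟨hclosed, hdisc⟩ := compl_mem_codiscrete_iff.1 hcod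
  have hfin : (((fun t : ℝ ↦ (1 / 2 : ℂ) + t * I) '' Icc a b) ∩ F ⁻¹' {0}).Finite :=
    (hK.inter_right hclosed).finite (hdisc.mono inter_subset_right)
  refine (Set.Finite.of_finite_image (hfin.subset ?_) critLine_injective'.injOn).subset
    (inter_subset_inter_right _ hS)
  rintro _ ⟨t, ⟨ht0, ht⟩, rfl⟩
  exact ⟨⟨t, ht, rfl⟩, ht0⟩

/-- If strictly between any two points of `S` there is a point of `T`, then `#S ≤ #T + 1`. [folklore] -/
private theorem card_le_card_add_one_of_forall_exists_btwn' {S T : Finset ℝ}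
    (h : ∀ x ∈ S, ∀ y ∈ S, x < y → ∃ z ∈ T, x < z ∧ z < y) : S.card ≤ T.card + 1 := by
  suffices key : ∀ S : Finset ℝ, (∀ x ∈ S, ∀ y ∈ S, x < y → ∃ z ∈ T, x < z ∧ z < y) →
      ∀ m ∈ S, (∀ x ∈ S, x ≤ m) → S.card ≤ (T.filter (· < m)).card + 1 by
    rcases S.eq_empty_or_nonempty with rfl | hne
    · simp
    · exact (key S h (S.max' hne) (S.max'_mem hne) (fun x hx ↦ S.le_max' x hx)).trans
        (by gcongr; exact Finset.filter_subset _ _)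
  intro S
  induction S using Finset.induction_on_max with
  | empty => intro _ m hm; simp at hm
  | insert a S ha ih =>
    intro hS m hm hmax
    have hma : m = a := by
      have h1 := hmax a (Finset.mem_insert_self a S)
      rcases Finset.mem_insert.1 hm with rfl | hm'
      · rfl
      · exact absurd h1 (not_le.2 (ha m hm'))
    subst hma
    have haS : m ∉ S := fun h' ↦ lt_irrefl _ (ha m h')
    rw [Finset.card_insert_of_notMem haS]
    rcases S.eq_empty_or_nonempty with rfl | hne
    · simp
    · set m' := S.max' hne with hm'
      have hm'S : m' ∈ S := S.max'_mem hne
      have hm'lt : m' < m := ha m' hm'S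
      have hS' : ∀ x ∈ S, ∀ y ∈ S, x < y → ∃ z ∈ T, x < z ∧ z < y := fun x hx y hy hxy ↦
        hS x (Finset.mem_insert_of_mem hx) y (Finset.mem_insert_of_mem hy) hxy
      have ih' := ih hS' m' hm'S (fun x hx ↦ S.le_max' x hx)
      obtain ⟨z, hzT, hz1, hz2⟩ := hS m' (Finset.mem_insert_of_mem hm'S) m (Finset.mem_insert_self _ _) hm'lt
      have hsub : insert z (T.filter (· < m')) ⊆ T.filter (· < m) := by
        intro w hw
        rcases Finset.mem_insert.1 hw with rfl | hw'
        · exact Finset.mem_filter.2 ⟨hzT, hz2⟩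
        · obtain ⟨hwT, hwlt⟩ := Finset.mem_filter.1 hw'
          exact Finset.mem_filter.2 ⟨hwT, hwlt.trans hm'lt⟩
      have hz_notMem : z ∉ T.filter (· < m') := fun hz ↦ lt_irrefl _ ((Finset.mem_filter.1 hz).2.trans hz1)
      have hcard := Finset.card_le_card hsub
      rw [Finset.card_insert_of_notMem hz_notMem] at hcard
      omega

/-- **Dividing out one critical-line zero**: if `(s − s₀) F₁(s) = i F(s)` identically (`F`, `F₁` entire, `F ≢ 0`),
then the multiplicities of `F` and `F₁` agree except at `s₀`, where they differ by one. [folklore] -/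
private theorem analyticOrderNatAt_of_sub_mul_eq {F F₁ : ℂ → ℂ} (hF : Differentiable ℂ F) (hF₁ : Differentiable ℂ F₁)
    {x : ℂ} (hx : F x ≠ 0) (s₀ : ℂ) (h : ∀ s, (s - s₀) * F₁ s = I * F s) (s : ℂ) :
    analyticOrderNatAt F s = analyticOrderNatAt F₁ s + (if s = s₀ then 1 else 0) := by
  have hlin : AnalyticAt ℂ (fun w : ℂ ↦ w - s₀) s := by fun_prop
  have hprod : analyticOrderAt (fun w ↦ (w - s₀) * F₁ w) s = analyticOrderAt (fun w : ℂ ↦ w - s₀) s + analyticOrderAt F₁ s :=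
    analyticOrderAt_mul hlin (hF₁.analyticAt s)
  have hIF : analyticOrderAt (fun w ↦ (w - s₀) * F₁ w) s = analyticOrderAt F s := by
    rw [show (fun w ↦ (w - s₀) * F₁ w) = fun w ↦ I * F w from funext h]
    rw [show (fun w ↦ I * F w) = (fun _ : ℂ ↦ I) * F from rfl, analyticOrderAt_mul analyticAt_const (hF.analyticAt s),
      analyticAt_const.analyticOrderAt_eq_zero.2 I_ne_zero, zero_add]
  have hlin_ord : analyticOrderAt (fun w : ℂ ↦ w - s₀) s = if s = s₀ then 1 else 0 := by
    split_ifs with hs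
    · subst hs
      exact hlin.analyticOrderAt_eq_one_of_zero_deriv_ne_zero (by simp) (by
        rw [deriv_sub_const, deriv_id'']; exact one_ne_zero)
    · exact hlin.analyticOrderAt_eq_zero.2 (sub_ne_zero.2 hs)
  have hFtop : analyticOrderAt F s ≠ ⊤ := analyticOrderAt_ne_top hF hx s
  have hF₁top : analyticOrderAt F₁ s ≠ ⊤ := by
    intro htop
    apply hFtop
    rw [← hIF, hprod, htop, add_top]
  -- pass to `ℕ`
  have key : (analyticOrderNatAt F s : ℕ∞) = analyticOrderNatAt F₁ s + (if s = s₀ then 1 else 0 : ℕ) := by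
    rw [Nat.cast_analyticOrderNatAt hFtop, Nat.cast_analyticOrderNatAt hF₁top, ← hIF, hprod, hlin_ord]
    rw [add_comm]
    split_ifs <;> simp
  exact_mod_cast key

/-- The finsum of the indicator of one point over `S`. [folklore] -/
private theorem finsum_mem_ite_eq_one (S : Set ℝ) (t₀ : ℝ) [DecidablePred (· ∈ S)] :
    ∑ᶠ t ∈ S, (if t = t₀ then 1 else 0 : ℕ) = if t₀ ∈ S then 1 else 0 := by
  classical
  split_ifs with h
  · rw [finsum_mem_eq_sum_of_subset (t := {t₀}) _ ?_ (by simpa using h)]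
    · simp
    · intro t ht
      have := ht.2
      simp only [Function.mem_support, ne_eq, ite_eq_right_iff, Classical.not_imp] at this
      simp [this.1]
  · rw [finsum_mem_eq_sum_of_subset (t := ∅) _ ?_ (by simp)]
    · simp
    · intro t ht
      have := ht.2
      simp only [Function.mem_support, ne_eq, ite_eq_right_iff, Classical.not_imp] at this
      exact absurd (this.1 ▸ ht.1) h

/-- The window count after dividing out a critical-line zero `s₀ = ½ + it₀`:
`N_F(S) = N_{F₁}(S) + [t₀ ∈ S]` for bounded windows `S`. [folklore] -/
private theorem critZeroCountOn_of_sub_mul_eq {F F₁ : ℂ → ℂ} (hF : Differentiable ℂ F) (hF₁ : Differentiable ℂ F₁)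
    {x : ℂ} (hx : F x ≠ 0) {x₁ : ℂ} (hx₁ : F₁ x₁ ≠ 0) (t₀ : ℝ)
    (h : ∀ s, (s - (1 / 2 + t₀ * I)) * F₁ s = I * F s) {S : Set ℝ} {a b : ℝ} (hS : S ⊆ Icc a b)
    [DecidablePred (· ∈ S)] :
    critZeroCountOn F S = critZeroCountOn F₁ S + (if t₀ ∈ S then 1 else 0) := by
  rw [critZeroCountOn_eq_finsum hF, critZeroCountOn_eq_finsum hF₁, ← finsum_mem_ite_eq_one S t₀]
  have hpt : ∀ t : ℝ, analyticOrderNatAt F (1 / 2 + t * I) =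
      analyticOrderNatAt F₁ (1 / 2 + t * I) + (if t = t₀ then 1 else 0) := by
    intro t
    rw [analyticOrderNatAt_of_sub_mul_eq hF hF₁ hx (1 / 2 + t₀ * I) h]
    congr 1
    simp only [add_right_inj, mul_eq_mul_right_iff, Complex.ofReal_inj, I_ne_zero, or_false]
  rw [finsum_mem_congr rfl (fun t _ ↦ hpt t)]
  refine finsum_mem_add_distrib' ?_ ?_
  · refine (finite_critZeroOrdinates_inter' hF₁ hx₁ hS).subset ?_
    rintro t ⟨htS, ht⟩
    refine ⟨?_, htS⟩
    rw [mem_critZeroOrdinates]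
    exact apply_eq_zero_of_analyticOrderNatAt_ne_zero ht
  · exact (Set.finite_singleton t₀).subset (by
      rintro t ⟨-, ht⟩
      simp only [Function.mem_support, ne_eq, ite_eq_right_iff, Classical.not_imp] at ht
      exact ht.1)


/-! ## Interlacing on a window free of critical-line zeros of `E` -/

section ZeroFreeWindow

variable {E : ℂ → ℂ} (hE : Differentiable ℂ E) (hHB : ∀ s : ℂ, 1 / 2 < s.re → ‖E (1 - conj s)‖ < ‖E s‖)
include hE hHB

omit hE in
/-- `E(1) ≠ 0` under (2.6) (apply it at `s = 1`). [folklore] -/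
private theorem critHB_apply_one_ne_zero : E 1 ≠ 0 := by
  intro h0
  have := hHB 1 (by norm_num)
  rw [h0, norm_zero] at this
  exact (norm_nonneg _).not_gt this

omit hE in
/-- `A(1) ≠ 0`, `B(1) ≠ 0` under (2.6) (all their zeros are on the critical line). [folklore] -/
private theorem critParts_apply_one_ne_zero : critRePart E 1 ≠ 0 ∧ critImPart E 1 ≠ 0 := by
  obtain ⟨hA, hB⟩ := lagarias2005_lemma_2_2_zeros hHB
  exact ⟨fun h0 ↦ by have := hA 1 h0; norm_num at this, fun h0 ↦ by have := hB 1 h0; norm_num at this⟩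

/-- **Interlacing on a zero-free window**: if `E` has no zero on the segment `{½+it : t ∈ [t₁,t₂]}`, the zero
counts of `A` and `B` on `(t₁,t₂]` differ by at most one. [cite: Lagarias2005, Lemma 2.2, proof (arXiv pp. 6–7; held text p0005)] -/
theorem critZeroCount_window_of_ne_zero {t₁ t₂ : ℝ} (ht : t₁ < t₂) (hne : ∀ t ∈ Icc t₁ t₂, E (1 / 2 + t * I) ≠ 0) :
    (critZeroCountOn (critRePart E) (Ioc t₁ t₂) : ℤ) - critZeroCountOn (critImPart E) (Ioc t₁ t₂) ≤ 1 ∧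
      (critZeroCountOn (critImPart E) (Ioc t₁ t₂) : ℤ) - critZeroCountOn (critRePart E) (Ioc t₁ t₂) ≤ 1 := by
  have _ := ht
  obtain ⟨hA1, hB1⟩ := critParts_apply_one_ne_zero hHB
  have hdA : Differentiable ℂ (critRePart E) := fun s ↦ (hasDerivAt_critRePart hE s).differentiableAt
  have hdB : Differentiable ℂ (critImPart E) := fun s ↦ (hasDerivAt_critImPart hE s).differentiableAt
  have hfinA : (critZeroOrdinates (critRePart E) ∩ Ioc t₁ t₂).Finite :=
    finite_critZeroOrdinates_inter' hdA hA1 Ioc_subset_Icc_self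
  have hfinB : (critZeroOrdinates (critImPart E) ∩ Ioc t₁ t₂).Finite :=
    finite_critZeroOrdinates_inter' hdB hB1 Ioc_subset_Icc_self
  rw [critZeroCountOn_eq_card_of hdA (fun t ht h0 ↦ deriv_critRePart_ne_zero_of_ne hE hHB (hne t (Ioc_subset_Icc_self ht)) h0) hfinA,
    critZeroCountOn_eq_card_of hdB (fun t ht h0 ↦ deriv_critImPart_ne_zero_of_ne hE hHB (hne t (Ioc_subset_Icc_self ht)) h0) hfinB]
  have h1 : hfinA.toFinset.card ≤ hfinB.toFinset.card + 1 := by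
    refine card_le_card_add_one_of_forall_exists_btwn' fun x hx y hy hxy ↦ ?_
    obtain ⟨hx0, hxI⟩ := hfinA.mem_toFinset.1 hx
    obtain ⟨hy0, hyI⟩ := hfinA.mem_toFinset.1 hy
    have hsub : Icc x y ⊆ Icc t₁ t₂ := Icc_subset_Icc hxI.1.le hyI.2
    obtain ⟨z, hz, hz0⟩ := exists_critImPart_zero_btwn hE hHB hxy (fun t ht ↦ hne t (hsub ht)) hx0 hy0
    exact ⟨z, hfinB.mem_toFinset.2 ⟨hz0, hxI.1.trans hz.1, hz.2.le.trans hyI.2⟩, hz.1, hz.2⟩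
  have h2 : hfinB.toFinset.card ≤ hfinA.toFinset.card + 1 := by
    refine card_le_card_add_one_of_forall_exists_btwn' fun x hx y hy hxy ↦ ?_
    obtain ⟨hx0, hxI⟩ := hfinB.mem_toFinset.1 hx
    obtain ⟨hy0, hyI⟩ := hfinB.mem_toFinset.1 hy
    have hsub : Icc x y ⊆ Icc t₁ t₂ := Icc_subset_Icc hxI.1.le hyI.2
    obtain ⟨z, hz, hz0⟩ := exists_critRePart_zero_btwn hE hHB hxy (fun t ht ↦ hne t (hsub ht)) hx0 hy0
    exact ⟨z, hfinA.mem_toFinset.2 ⟨hz0, hxI.1.trans hz.1, hz.2.le.trans hyI.2⟩, hz.1, hz.2⟩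
  constructor <;> omega

end ZeroFreeWindow

/-! ## Dividing out a critical-line zero of `E` -/

/-- The quotient `E₁(s) := i E(s)/(s − s₀)` (precisely `i · dslope E s₀`) at a critical-line zero `s₀ = ½ + it₀` of
`E`. The factor `i` keeps the decomposition aligned: `A_{E₁} = i A_E/(s − s₀)`, `B_{E₁} = i B_E/(s − s₀)`. [folklore] -/
private theorem sub_mul_dslope_eq {E : ℂ → ℂ} {s₀ : ℂ} (h0 : E s₀ = 0) (s : ℂ) :
    (s - s₀) * (I * dslope E s₀ s) = I * E s := by
  have := sub_smul_dslope E s₀ s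
  rw [h0, sub_zero, smul_eq_mul] at this
  rw [← this]
  ring

/-- `(s − s₀)♯ = −(s − s₀)` for `s₀` on the critical line. [folklore] -/
private theorem conj_one_sub_conj_sub (t₀ : ℝ) (s : ℂ) :
    conj ((1 : ℂ) - conj s - (1 / 2 + t₀ * I)) = -(s - (1 / 2 + t₀ * I)) := by
  simp only [map_sub, map_one, Complex.conj_conj, map_add, map_mul, Complex.conj_ofReal, Complex.conj_I, map_div₀,
    map_ofNat]
  ring

section Divide

variable {E : ℂ → ℂ} (hE : Differentiable ℂ E) {t₀ : ℝ} (h0 : E (1 / 2 + t₀ * I) = 0)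
include hE h0

/-- `E₁` is entire. [folklore] -/
private theorem differentiable_divided : Differentiable ℂ (fun s ↦ I * dslope E (1 / 2 + t₀ * I) s) := by
  have _ := h0
  have hd : Differentiable ℂ (dslope E (1 / 2 + t₀ * I)) := by
    have := (differentiableOn_dslope (Filter.univ_mem : (Set.univ : Set ℂ) ∈ 𝓝 ((1 / 2 : ℂ) + t₀ * I))).2
      hE.differentiableOn
    exact differentiableOn_univ.1 this
  exact (differentiable_const I).mul hd

omit hE in
/-- `A_{E₁}` satisfies `(s − s₀) A_{E₁}(s) = i A_E(s)`. [folklore] -/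
private theorem sub_mul_critRePart_divided (s : ℂ) :
    (s - (1 / 2 + t₀ * I)) * critRePart (fun s ↦ I * dslope E (1 / 2 + t₀ * I) s) s = I * critRePart E s := by
  have h1 := sub_mul_dslope_eq h0 s
  have h2 := sub_mul_dslope_eq h0 (1 - conj s)
  -- `(1 − s̄ − s₀) = −conj(s − s₀)`
  simp only [critRePart, critReflect_apply, map_mul, Complex.conj_I]
  have h2' : conj (((1 : ℂ) - conj s - (1 / 2 + t₀ * I)) * (I * dslope E (1 / 2 + ↑t₀ * I) (1 - conj s))) =
      conj (I * E (1 - conj s)) := by rw [h2]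
  simp only [map_mul, conj_one_sub_conj_sub, Complex.conj_I] at h2'
  linear_combination (h1 - h2') / 2

omit hE in
/-- `B_{E₁}` satisfies `(s − s₀) B_{E₁}(s) = i B_E(s)`. [folklore] -/
private theorem sub_mul_critImPart_divided (s : ℂ) :
    (s - (1 / 2 + t₀ * I)) * critImPart (fun s ↦ I * dslope E (1 / 2 + t₀ * I) s) s = I * critImPart E s := by
  have h1 := sub_mul_dslope_eq h0 s
  have h2 := sub_mul_dslope_eq h0 (1 - conj s)
  simp only [critImPart, critReflect_apply, map_mul, Complex.conj_I]
  have h2' : conj (((1 : ℂ) - conj s - (1 / 2 + t₀ * I)) * (I * dslope E (1 / 2 + ↑t₀ * I) (1 - conj s))) =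
      conj (I * E (1 - conj s)) := by rw [h2]
  simp only [map_mul, conj_one_sub_conj_sub, Complex.conj_I] at h2'
  linear_combination (I * (h1 + h2')) / 2

omit hE in
/-- `E₁` again satisfies (2.6). [folklore] -/
private theorem critHB_divided (hHB : ∀ s : ℂ, 1 / 2 < s.re → ‖E (1 - conj s)‖ < ‖E s‖) :
    ∀ s : ℂ, 1 / 2 < s.re → ‖(fun s ↦ I * dslope E (1 / 2 + t₀ * I) s) (1 - conj s)‖ <
      ‖(fun s ↦ I * dslope E (1 / 2 + t₀ * I) s) s‖ := by
  intro s hs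
  have hs0 : s - (1 / 2 + t₀ * I) ≠ 0 := by
    intro h; have := congrArg Complex.re h; simp at this; linarith
  have hs1 : (1 : ℂ) - conj s - (1 / 2 + t₀ * I) ≠ 0 := by
    intro h; have := congrArg Complex.re h; simp at this; linarith
  have hn : ‖(1 : ℂ) - conj s - (1 / 2 + t₀ * I)‖ = ‖s - (1 / 2 + t₀ * I)‖ := by
    rw [← Complex.norm_conj, conj_one_sub_conj_sub, norm_neg]
  have h1 := congrArg (‖·‖) (sub_mul_dslope_eq h0 s)
  have h2 := congrArg (‖·‖) (sub_mul_dslope_eq h0 (1 - conj s))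
  simp only [norm_mul, Complex.norm_I, one_mul, hn] at h1 h2
  have hpos : 0 < ‖s - (1 / 2 + t₀ * I)‖ := norm_pos_iff.2 hs0
  have key := hHB s hs
  rw [← h1, ← h2] at key
  simp only [norm_mul, Complex.norm_I, one_mul]
  exact lt_of_mul_lt_mul_left key hpos.le

end Divide

/-! ## The induction on the number of critical-line zeros of `E` in the window, and the discharge -/

/-- If `E` (entire, `≢ 0`) has a zero on the segment over `[t₁,t₂]`, its total multiplicity there is positive.
[folklore] -/
private theorem critZeroCountOn_pos_of_zero {E : ℂ → ℂ} (hE : Differentiable ℂ E) {x : ℂ} (hx : E x ≠ 0)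
    {t₁ t₂ t : ℝ} (ht : t ∈ Icc t₁ t₂) (h0 : E (1 / 2 + t * I) = 0) : 0 < critZeroCountOn E (Icc t₁ t₂) := by
  have hfin : (critZeroOrdinates E ∩ Icc t₁ t₂).Finite := finite_critZeroOrdinates_inter' hE hx subset_rfl
  unfold critZeroCountOn
  rw [finsum_mem_eq_finite_toFinset_sum _ hfin]
  have hmem : t ∈ hfin.toFinset := hfin.mem_toFinset.2 ⟨h0, ht⟩
  refine lt_of_lt_of_le ?_ (Finset.single_le_sum (fun _ _ ↦ Nat.zero_le _) hmem)
  rw [pos_iff_ne_zero]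
  intro hz
  have hne : analyticOrderAt E (1 / 2 + t * I) ≠ 0 := (hE.analyticAt _).analyticOrderAt_ne_zero.2 h0
  have htop := analyticOrderAt_ne_top hE hx (1 / 2 + t * I)
  rw [analyticOrderNatAt, ENat.toNat_eq_zero] at hz
  rcases hz with hz | hz
  · exact hne hz
  · exact htop hz

/-- **The window inequality, by induction on the multiplicity of `E` on the closed segment.**
[cite: Lagarias2005, Lemma 2.2 (arXiv p. 6; held text p0005 L12)] -/
private theorem critZeroCount_window : ∀ (M : ℕ) (E : ℂ → ℂ), Differentiable ℂ E →
    (∀ s : ℂ, 1 / 2 < s.re → ‖E (1 - conj s)‖ < ‖E s‖) → ∀ t₁ t₂ : ℝ, t₁ < t₂ →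
    critZeroCountOn E (Icc t₁ t₂) = M →
    (critZeroCountOn (critRePart E) (Ioc t₁ t₂) : ℤ) - critZeroCountOn (critImPart E) (Ioc t₁ t₂) ≤ 1 ∧
      (critZeroCountOn (critImPart E) (Ioc t₁ t₂) : ℤ) - critZeroCountOn (critRePart E) (Ioc t₁ t₂) ≤ 1 := by
  intro M
  induction M with
  | zero =>
    intro E hE hHB t₁ t₂ ht hM
    refine critZeroCount_window_of_ne_zero hE hHB ht fun t htI h0 ↦ ?_
    have := critZeroCountOn_pos_of_zero hE (critHB_apply_one_ne_zero hHB) htI h0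
    omega
  | succ M ih =>
    intro E hE hHB t₁ t₂ ht hM
    classical
    -- there is a zero `s₀ = ½ + it₀` of `E` on the segment
    obtain ⟨t₀, ht₀I, h0⟩ : ∃ t₀ ∈ Icc t₁ t₂, E (1 / 2 + t₀ * I) = 0 := by
      by_contra hcon
      push Not at hcon
      have : critZeroCountOn E (Icc t₁ t₂) = 0 := by
        unfold critZeroCountOn
        rw [show critZeroOrdinates E ∩ Icc t₁ t₂ = ∅ from ?_, finsum_mem_empty]
        ext t
        simp only [mem_inter_iff, mem_critZeroOrdinates, mem_empty_iff_false, iff_false, not_and]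
        exact fun h ht ↦ hcon t ht h
      omega
    -- divide it out
    set E₁ : ℂ → ℂ := fun s ↦ I * dslope E (1 / 2 + t₀ * I) s with hE₁
    have hE₁d : Differentiable ℂ E₁ := differentiable_divided hE h0
    have hHB₁ : ∀ s : ℂ, 1 / 2 < s.re → ‖E₁ (1 - conj s)‖ < ‖E₁ s‖ := critHB_divided h0 hHB
    have hx : E 1 ≠ 0 := critHB_apply_one_ne_zero hHB
    have hx₁ : E₁ 1 ≠ 0 := critHB_apply_one_ne_zero hHB₁
    obtain ⟨hA1, hB1⟩ := critParts_apply_one_ne_zero hHB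
    obtain ⟨hA₁1, hB₁1⟩ := critParts_apply_one_ne_zero hHB₁
    have hdA : Differentiable ℂ (critRePart E) := fun s ↦ (hasDerivAt_critRePart hE s).differentiableAt
    have hdB : Differentiable ℂ (critImPart E) := fun s ↦ (hasDerivAt_critImPart hE s).differentiableAt
    have hdA₁ : Differentiable ℂ (critRePart E₁) := fun s ↦ (hasDerivAt_critRePart hE₁d s).differentiableAt
    have hdB₁ : Differentiable ℂ (critImPart E₁) := fun s ↦ (hasDerivAt_critImPart hE₁d s).differentiableAt
    -- multiplicity of `E₁` on the segment is `M`
    have hM₁ : critZeroCountOn E₁ (Icc t₁ t₂) = M := by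
      have := critZeroCountOn_of_sub_mul_eq hE hE₁d hx hx₁ t₀ (fun s ↦ sub_mul_dslope_eq h0 s)
        (subset_rfl : Icc t₁ t₂ ⊆ Icc t₁ t₂)
      rw [if_pos ht₀I] at this
      omega
    have ih' := ih E₁ hE₁d hHB₁ t₁ t₂ ht hM₁
    -- transfer the window counts
    have hA := critZeroCountOn_of_sub_mul_eq hdA hdA₁ hA1 hA₁1 t₀ (fun s ↦ sub_mul_critRePart_divided h0 s)
      (Ioc_subset_Icc_self : Ioc t₁ t₂ ⊆ Icc t₁ t₂)
    have hB := critZeroCountOn_of_sub_mul_eq hdB hdB₁ hB1 hB₁1 t₀ (fun s ↦ sub_mul_critImPart_divided h0 s)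
      (Ioc_subset_Icc_self : Ioc t₁ t₂ ⊆ Icc t₁ t₂)
    rw [hA, hB]
    push_cast
    constructor <;> linarith [ih'.1, ih'.2]

/-- **Lagarias 2005, Lemma 2.2, second conclusion** (de Branges' lemma) — discharge of
`lagarias2005_lemma_2_2_interlace` (RH-FREE): for an entire `E` with `|E(s)| > |E(1 − s̄)|` on `Re s > ½`, the
critical-line zeros of `A = ½(E + E♯)` and `B = (i/2)(E − E♯)` interlace, counting multiplicity. The printed phase
argument ((2.7)–(2.8): the phase of `E(½+it)` is non-decreasing and non-constant) is sharpened to STRICT positivity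
of the phase velocity `Re E′/E(½+it)` (Harnack's inequality for `log|E| − log|E♯|` in a disc tangent to the critical
line — the boundary-point lemma; tree `Literature.Analysis.Approximation.TuranNazarov.harnack` over Mathlib's
Poisson formula), which gives simplicity and strict alternation of the zeros of `A`, `B` away from the critical-line
zeros of `E`; the latter are divided out one at a time (`E ↦ iE/(s − s₀)`, which preserves (2.6) and shifts the
multiplicities of `E`, `A`, `B` at `s₀` by one each). [cite: Lagarias2005, Lemma 2.2 (arXiv p. 6; held text p0005 L12)] -/
theorem lagarias2005_lemma_2_2_interlace_holds : lagarias2005_lemma_2_2_interlace := by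
  intro E hE hHB t₁ t₂ ht
  exact critZeroCount_window _ E hE hHB t₁ t₂ ht rfl

end Literature.NumberTheory.LFunctions
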